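import Literature.Analysis.FluidPDE.FracNSShortTimeExistence
import Literature.Analysis.FluidPDE.LerayHopfFrac
import HarnessLib

/-!
# Short-time classical solutions of the Navier–Stokes equations on `T^d` (`d ≤ 3`) from smooth data

Analysis/FluidPDE proofs file (everything proved; no definitions, no named facts).  The tree's Fourier–Galerkin
energy method (`GalerkinSmoothHm` … `GalerkinSmoothSolution`, assembled in `FracNSShortTimeExistence`) produces smooth
short-time solutions of the FRACTIONAL system `∂ₜv + (v·∇)v + ∇p + ν(-Δ)^γ v = 0` for every `0 ≤ γ ≤ 1`, `ν ≥ 0`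
(`Torus.exists_fracNS_smooth_of_sobolevBound`, stated with the solution notion `Torus.IsFracNSReynoldsOn` at zero Reynolds
stress).  At `γ = 1` this IS the classical incompressible Navier–Stokes system (`Torus.fracLaplacian_one`:
`(-Δ)^1 a = -Δa` on smooth fields), and this file records that reading in the vocabulary of the rest of the tree
(`Torus.IsClassicalNSSolutionOn`, the accepted classical-solution notion of `TorusFluidGlue`):

* `Torus.IsFracNSReynoldsOn.isClassicalNSSolutionOn_one` — a solution of the fractional system with `γ = 1` and vanishing
  stress on a time set of unique differentiability is a classical solution of the unforced Navier–Stokes system there;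
* `Torus.exists_classicalNS_smooth_of_sobolevBound` — **quantitative local existence**: a constant `c = c(d) > 0` such that
  for every `ν ≥ 0` and every smooth divergence-free `u₀` with `∑_{k∈S} (1+|k|²)⁴‖û₀(k)‖² ≤ M` (all finite `S`), every
  `0 < T` with `T √M ≤ c` carries a classical solution `(v, p)` on `[0, T] × T^d` with `v(0) = u₀` and mean-zero pressure
  (life span `≳ ‖u₀‖_{H⁴}⁻¹`, the form consumed by continuation arguments);
* `Torus.exists_classicalNS_smooth` — the qualitative corollary (some `T > 0`).

These are Majda–Bertozzi 2002, Thm. 3.4 (local existence of `H^m` solutions, `m > d/2 + 1`, by the energy method, viscosity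
`ν ≥ 0` uniform) read for smooth data on the torus; Robinson–Rodrigo–Sadowski 2016, Thm. 7.5 / §7.2 for the classical
(smooth-data) local theory on `T³`.  The FORCED Cauchy problem is not treated here (the Galerkin files carry only a linear
damping force).

## Tree / Mathlib search

Tree: `Torus.exists_fracNS_smooth_of_sobolevBound`, `GalerkinSmooth.exists_latticeBound`, `GalerkinSmooth.exists_sobolevSum_le`
(`FracNSShortTimeExistence`), `Torus.fracLaplacian_one` (`LerayHopfFrac`), `Torus.IsFracNSReynoldsOn` (`FractionalNSReynolds`),
`Torus.tensorDivergence_zero`; compare `IsNSReynoldsOn.isClassicalNSSolutionOn_of_stress_eq_zero` (`NavierStokesReynolds`).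
`lean search 'exists_classicalNS'`: only `Torus.exists_classicalNS_of_bounded_data` (ν = 1, bounded data, open window,
`PeriodicBoundedMildTorus`) — no smooth-data / general-`ν` statement in the classical vocabulary.

## References

* A. J. Majda, A. L. Bertozzi, *Vorticity and Incompressible Flow*, CUP 2002, Thm. 3.4. [MajdaBertozziCUP2002]
* J. C. Robinson, J. L. Rodrigo, W. Sadowski, *The Three-Dimensional Navier–Stokes Equations*, CUP 2016, Thm. 7.5, §7.2.
  [RobinsonRodrigoSadowskiCUP2016]
-/

noncomputable section

open MeasureTheory Set Filter Topology Function UnitAddTorus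

namespace Literature.Analysis.FluidPDE

open FunctionSpaces FunctionSpaces.Torus

variable {d : Type*} [Fintype d] [DecidableEq d]

namespace Torus

/-! ## `γ = 1`: the fractional system is the Navier–Stokes system -/

/-- **At `γ = 1` and zero stress, a solution of the fractional Navier–Stokes–Reynolds system is a classical solution of the
unforced Navier–Stokes system** on any time subset of unique differentiability: `ν(-Δ)^1 v = -νΔv` on the smooth slices
(`Torus.fracLaplacian_one`) and `div 0 = 0`. [cite: MajdaBertozziCUP2002, Thm. 3.4 (the case of the Laplacian)] -/
theorem IsFracNSReynoldsOn.isClassicalNSSolutionOn_one {S : Set ℝ} {ν : ℝ}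
    {v : ℝ → UnitAddTorus d → EuclideanSpace ℝ d} {p : ℝ → UnitAddTorus d → ℝ}
    {R : ℝ → UnitAddTorus d → d → EuclideanSpace ℝ d} (h : IsFracNSReynoldsOn S 1 ν v p R)
    {S' : Set ℝ} (hS' : S' ⊆ S) (hU : UniqueDiffOn ℝ S') (hR : ∀ t ∈ S', ∀ x, R t x = 0) :
    FunctionSpaces.Torus.IsClassicalNSSolutionOn S' ν 0 v p where
  smooth_velocity := h.smooth_velocity.mono hS'
  smooth_pressure := h.smooth_pressure.mono hS'
  momentum t ht x := by
    have h1 : FunctionSpaces.Torus.timeDerivWithin S' v t x = FunctionSpaces.Torus.timeDerivWithin S v t x := by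
      have hd : HasDerivWithinAt (fun τ => v τ x) (FunctionSpaces.Torus.timeDerivWithin S v t x) S' t :=
        (h.smooth_velocity.hasDerivWithinAt_slice (hS' ht) x).mono hS'
      exact hd.derivWithin (hU t ht)
    have hR0 : R t = fun _ _ => 0 := by
      funext y j
      rw [hR t ht y]
      rfl
    have hvt : IsSmooth (v t) := h.smooth_velocity.isSmooth_slice (hS' ht)
    have hm := h.momentum t (hS' ht) x
    rw [hR0, tensorDivergence_zero, fracLaplacian_one_apply hvt, smul_neg, add_neg_eq_zero] at hm
    rw [h1, Pi.zero_apply, Pi.zero_apply, add_zero]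
    exact eq_sub_of_add_eq hm
  divFree t ht := h.divFree t (hS' ht)

/-! ## Local existence from smooth data -/

/-- **Quantitative short-time existence of classical Navier–Stokes solutions from smooth data on `T^d`, `d ≤ 3`**:
there is `c = c(d) > 0` such that for every viscosity `ν ≥ 0`, every smooth divergence-free datum `u₀` whose fourth
Sobolev sums are bounded by `M > 0` (`∑_{k∈S} (1+|k|²)⁴‖û₀(k)‖² ≤ M` for all finite `S ⊆ ℤ^d`), and every `0 < T` with
`T √M ≤ c`, the unforced Navier–Stokes system has a classical solution `(v, p)` on `[0, T] × T^d` with `v(0) = u₀` and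
`∫ p(t) = 0` — the life span is at least `c ‖u₀‖_{H⁴}⁻¹`.  The tree's Galerkin energy method at `γ = 1`
(`Torus.exists_fracNS_smooth_of_sobolevBound` with the lattice constant of `GalerkinSmooth.exists_latticeBound`).
[cite: MajdaBertozziCUP2002, Thm. 3.4] -/
theorem exists_classicalNS_smooth_of_sobolevBound (hd : Fintype.card d ≤ 3) :
    ∃ c : ℝ, 0 < c ∧ ∀ {ν : ℝ}, 0 ≤ ν → ∀ {u₀ : UnitAddTorus d → EuclideanSpace ℝ d}, IsSmooth u₀ → IsDivFree u₀ →
      ∀ {M : ℝ}, 0 < M →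
        (∀ S : Finset (d → ℤ), ∑ k ∈ S, (1 + freqNormSq k) ^ 4 * ‖mFourierCoeff (EuclideanSpace.complexify ∘ u₀) k‖ ^ 2 ≤ M) →
        ∀ {T : ℝ}, 0 < T → T * Real.sqrt M ≤ c →
          ∃ (v : ℝ → UnitAddTorus d → EuclideanSpace ℝ d) (p : ℝ → UnitAddTorus d → ℝ),
            FunctionSpaces.Torus.IsClassicalNSSolutionOn (Icc 0 T) ν 0 v p ∧ v 0 = u₀ ∧
              ∀ t ∈ Icc 0 T, HasZeroMean (p t) := by
  obtain ⟨B, hB⟩ := GalerkinSmooth.exists_latticeBound (d := d) hd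
  -- the life-span constant of the Galerkin energy method
  set L : ℝ := ((Fintype.card d * (2 * (2 ^ 4 * (Fintype.card d * Real.sqrt B * (2 * Real.pi) ^ (2 * 4 + 1)))) *
      (((Fintype.card d : ℝ) + 1) ^ 3 * Real.sqrt (((Fintype.card d : ℝ) + 1) ^ 3)) + 1) *
      Real.sqrt (1 + Fintype.card d * (2 * Real.pi) ^ (2 * 4))) with hL
  have hL0 : 0 < L := by
    rw [hL]
    positivity
  refine ⟨L⁻¹, inv_pos.2 hL0, fun {ν} hν {u₀} hu₀ hdiv {M} hM hMu {T} hT hTc => ?_⟩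
  have hTM : T * (L * Real.sqrt M) ≤ 1 := by
    have := mul_le_mul_of_nonneg_left hTc hL0.le
    rw [mul_inv_cancel₀ hL0.ne'] at this
    calc T * (L * Real.sqrt M) = L * (T * Real.sqrt M) := by ring
      _ ≤ 1 := this
  obtain ⟨v, p, hsol, hv0, hp⟩ :=
    exists_fracNS_smooth_of_sobolevBound hB zero_le_one le_rfl hν hu₀ hdiv hM hMu hT (by rw [hL] at hTM; exact hTM)
  exact ⟨v, p, hsol.isClassicalNSSolutionOn_one Subset.rfl (uniqueDiffOn_Icc hT) (fun _ _ _ => rfl), hv0, hp⟩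

/-- **Short-time classical Navier–Stokes solutions from smooth divergence-free data on `T^d`, `d ≤ 3`** (qualitative form):
for `ν ≥ 0` there are `T > 0` and a classical solution `(v, p)` of the unforced system on `[0, T] × T^d` with `v(0) = u₀`
and mean-zero pressure (the fourth Sobolev sums of a smooth field are finite, `GalerkinSmooth.exists_sobolevSum_le`).
[cite: MajdaBertozziCUP2002, Thm. 3.4] -/
theorem exists_classicalNS_smooth (hd : Fintype.card d ≤ 3) {ν : ℝ} (hν : 0 ≤ ν)
    {u₀ : UnitAddTorus d → EuclideanSpace ℝ d} (hu₀ : IsSmooth u₀) (hdiv : IsDivFree u₀) :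
    ∃ T : ℝ, 0 < T ∧ ∃ (v : ℝ → UnitAddTorus d → EuclideanSpace ℝ d) (p : ℝ → UnitAddTorus d → ℝ),
      FunctionSpaces.Torus.IsClassicalNSSolutionOn (Icc 0 T) ν 0 v p ∧ v 0 = u₀ ∧
        ∀ t ∈ Icc 0 T, HasZeroMean (p t) := by
  obtain ⟨c, hc, hex⟩ := exists_classicalNS_smooth_of_sobolevBound (d := d) hd
  obtain ⟨U, hU⟩ := GalerkinSmooth.exists_sobolevSum_le hu₀ 4
  set M : ℝ := max U 1 with hM
  have hM0 : 0 < M := lt_of_lt_of_le one_pos (le_max_right _ _)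
  have hMu : ∀ S : Finset (d → ℤ),
      ∑ k ∈ S, (1 + freqNormSq k) ^ 4 * ‖mFourierCoeff (EuclideanSpace.complexify ∘ u₀) k‖ ^ 2 ≤ M :=
    fun S => (hU S).trans (le_max_left _ _)
  set T : ℝ := c / Real.sqrt M with hT
  have hsM : 0 < Real.sqrt M := Real.sqrt_pos.2 hM0
  have hT0 : 0 < T := div_pos hc hsM
  refine ⟨T, hT0, hex hν hu₀ hdiv hM0 hMu hT0 (le_of_eq ?_)⟩
  rw [hT, div_mul_cancel₀ c hsM.ne']

end Torus

end Literature.Analysis.FluidPDE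

end
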